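import Summits.CriticalPhenomena.Ising3D.Control2DL19OpeUCTable
import Mathlib.Tactic.NormNum
import HarnessLib

/-!
# RB-6 ope2 (sense upper) certificate `j137089_functional_deriv2d_L19_E048_sig1o8_ope2upper_P78129o5000000.json` (Λ = 19, E₀ = 48): p_T < 78129/5000000 at Δ_σ = 1/8 under A2D′ with the ε box [49/50, 20001/20000] (⇒ c > (1/8)²/(2·78129/5000000) = 0.4999744 by the Ward identity) — (R), the large-`S` half, leaf chunks E (8 leaves)
(cell `pub-ising3x`, seat controls-1 gen 20; KERNEL PATH for the 2D γ-certificates, Λ = 19 — CONTROL-ONLY)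

HONEST FRAMING: lottery ticket; floor = tightest certified 3D Ising CFT bounds; no exact-solution
claim without a proof. CONTROL-ONLY (`d = 2`, `Δ_σ = 1/8`, the 2D Ising control; axiom set `A2D′`).

(R) for the table `wtopeUC` (`Control2DL19OpeUCTable`), kernel data only: the compactified region polynomial `QhatopeUC`
(`S₁ = 72`, `d = 19`) is non-negative on `τ ∈ [0,1]`, `v ∈ [0,1]` by the tensor-Bernstein SHAPE tree `cregopeUC`
(58 leaves; every Bernstein coefficient computed and decided in the kernel, `Control2DPolyCertAuto2`, in 10 chunks of
≤ 12 leaves re-assembled along the splits), and `S ≤ S₁` by the per-`J` shapes `cregJopeUC` of the Table file;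
the root fact `cregopeUC_n0` and the per-`J` fact `cregJopeUC_ok` are turned into hypothesis `hR` by `region_of_kernelCertAuto` INSIDE the assembly file `Control2DL19OpeUC` (no standalone `region_opeUC` theorem: its statement would coincide, up to the table's name, with the other Λ = 19 boxes' — gate dedup lint, controls-1 g17). No facts, standard axioms only.

SPLIT (controls-1 g19): the gate caps one file at 600 s of elaboration and the whole 86-leaf tree took 613 s, so the kernel-decided
leaf CHUNKS live in `Control2DL19OpeUCRegionA…` files (≤ 18 leaves each) and `Control2DL19OpeUCRegion` re-assembles the nodes. This file: chunks cregopeUC_n18.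
-/

namespace Summit.CriticalPhenomena.Ising3D.Control2D

open Literature.MathematicalPhysics.QuantumFieldTheory.ConformalBootstrap3D

set_option maxHeartbeats 0 in
set_option maxRecDepth 200000 in
/-- Chunk 18 of the large-`S` tree (box `q₁=32, a₁=31; q₂=16, a₂=15`; 8 leaves), decided in the kernel. [folklore] -/
theorem cregopeUC_n18 :
    checkAuto₂ QhatopeUC 20 32 31 1 16 15 1
    (Shape₂.splitI (Shape₂.splitO (Shape₂.splitI (Shape₂.leaf) (Shape₂.leaf)) (Shape₂.splitI (Shape₂.splitO (Shape₂.splitI (Shape₂.leaf) (Shape₂.leaf)) (Shape₂.splitI (Shape₂.leaf) (Shape₂.leaf))) (Shape₂.leaf))) (Shape₂.leaf)) = true := by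
  decide +kernel

end Summit.CriticalPhenomena.Ising3D.Control2D
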